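import Mathlib
import Literature.MathematicalPhysics.QuantumFieldTheory.Balaban1983to89.Beta.TorusG0DivDecay
import Literature.MathematicalPhysics.QuantumFieldTheory.Balaban1983to89.QGQInverse

/-!
# Beta / CombesThomasKernel — the conjugation defect of a NON-LOCAL kernel (Schur with the decay weight), and
Combes–Thomas decay for `H = −Δ^η + aQ*Q + K` on the torus type, uniformly in the mesh

HONEST FRAMING (verbatim, page 1 of everything this cell writes): discharging `BetaPertH` makes Bałaban's UV
stability UNCONDITIONAL — a real constructive-QFT result; it is NOT the continuum limit and NOT the Clay problem.
Gloss (BETA-SPEC v1.9b l. 17–18, G-ref2-14 (a) / G-ref2-20 (a), verbatim): «UNCONDITIONAL» in [Balaban1989LargeFieldII]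
(B16, CMP 122) p. 355's interval-hypothesis sense ONLY (`FlowStepRuns.p355Unconditional_of_partialSums` keeps `hnodes`);
the located leaves G-adv3-2 (left inequality of (0.1)/(2.50), d = 4), G-adv3-1 (U2 transfer of B14 Cor. 3's lower
bound) and `SecondExpLeaf` REMAIN.  Gloss 2 (BETA-SPEC v1.9e 22:38Z, beta-ref C-beta-78, BINDING, verbatim): «UNCONDITIONAL» =
`Beta.Assembly.EventualForm`-unconditional — the END statement with the interval hypothesis removed, (0.31) in DEFECTED form
on all lattices (`PrefixAbsorption.thm2Defected_of_eventualForm`), admissible couplings shrunk to g ≤ g⋆; NOT «B12 Theorem 2 as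
printed» (that needs (AF-0s) or (AF-0-L) ∀k at L ≥ L₁ in addition: `eventualForm_not_thm2Printed`, RULING (R6)); never the
continuum limit / mass gap / Clay.  THIS MODULE discharges nothing of that and makes NO UV-stability claim at all: it
is a Mathlib-elementary kernel certificate (v1.0.1/v1.0.2 = v1 + this paragraph, docstring-only — beta-ref R129/R150,
ref2 G-ref2-20 (a); no declaration changed).

SCOPE.  Mathlib-elementary; nothing printed by Bałaban is asserted, no hypothesis is a quotation.  The
sibling modules run the quadratic-form Combes–Thomas argument (`CombesThomasForm.combesThomas_form`,
`CombesThomasFormOp.combesThomas_form_op`: coercivity `σ‖ω‖² ≤ ⟨ω, Hω⟩` + a conjugation DEFECT bound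
`−(σ/2)‖w‖² ≤ Σ_{j,k} (e^{φ_j−φ_k} − 1) H_jk w_j w_k` ⇒ `ℓ²` decay of `H⁻¹` at rate `φ`) and bound the defect for the
two LOCAL building blocks `η`-uniformly: a graph Laplacian with `η⁻²` bonds (`conjError_lap_ge`, second order in the
weight step thanks to the symmetrisation `e^t − 1 ↦ cosh t − 1`) and block rank-one averaging terms
(`conjError_blocks_ge`); the torus chain (`TorusG0Decay` … `TorusG0DivDecay`) instantiates this for
`G₀ = (−Δ^η + aQ*Q)⁻¹`.  THIS MODULE adds the defect bound for a third kind of summand — an arbitrary real KERNEL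
`K` (non-local, any range) — so that the same two-hypothesis engine applies to `H = lap c + blocks + K`, and runs the
torus instance `H = torusOp n M a + K`:

* §1 (generic, any finite index type).  `conjError_kernel_ge`: for ANY real `K`, the defect is
  `≥ −ρ‖w‖²` as soon as the `(e^{|φ_j−φ_k|} − 1)`-weighted absolute ROW and COLUMN sums of `K` are `≤ ρ` (finite Schur
  test in quadratic-form form, `QGQInverse.form_abs_le_of_schur`, reused by name) — first order in (weight step) ×
  (range).  `conjError_symmKernel_ge`: for SYMMETRIC `K` the odd (`sinh`) part of the defect cancels identically
  (`defect_symm_eq_cosh`: `Σ (e^{φ_j−φ_k} − 1) K_jk w_j w_k = Σ (cosh(φ_j−φ_k) − 1) K_jk w_j w_k` for every symmetric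
  `K` and every `φ`), so the defect is `≥ −ρ‖w‖²` with `ρ` bounding only the `(cosh(φ_j−φ_k) − 1)`-weighted absolute
  ROW sums — SECOND order: an `η⁻²`-sized symmetric kernel of range `≲ η` has `ρ = O(δ²)` uniformly in `η`
  (this contains `conjError_lap_ge` as the case `K = −c` off the diagonal).  Lipschitz-weight corollaries
  (`…_of_lipschitz`: `|φ_j − φ_k| ≤ θ·dist(j,k)` turns the hypotheses into WEIGHT-FREE geometric ones,
  `Σ_k |K_jk| (cosh(θ dist(j,k)) − 1) ≤ ρ`), additivity of defects (`conjError_add`), transfer of coercivity to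
  `H₁ + K` (`coercive_add_of_form_nonneg`: `K ≥ 0` as a form keeps `σ`; `coercive_add_of_schur`: plain Schur sums
  `≤ ρ₀` give `σ − ρ₀`), and `eq_zero_of_coercive` (a coercive `H` has trivial kernel).
* §2 (generic lattice shape, metric form).  `defect_ge_lattice_kernel_dist` / `setDecay_lattice_kernel_dist`: the
  sibling `setDecay_lattice_dist` with a symmetric kernel `K` added to `H = lap c + Σ_b m_b u_b⊗u_b`; the `η`-free
  smallness becomes `z δ² + a (e^{δD} − 1) + ρ ≤ σ/2` with `ρ ≥ Σ_k |K_jk| (cosh(δ d(j,k)) − 1)`; conclusion unchanged: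
  `Σ_{i∈S} (H⁻¹g)_i² ≤ (2/σ)² e^{−2δR} Σ_j g_j²` for `g` supported in `T`, `d(S,T) ≥ R`.
* §3 (the torus type `T_η = Tor (fine (n+1) M)`, `η = 1/(n+1)`, periods `(n+1)M_μ ≥ 3`, `a > 0`, `0 ≤ δ ≤ 1`).  For
  `H = torusOp n M a + K`, `K` symmetric: `torusKernel_defect_ge` (defect `≥ −(2dδ² + a(e^δ − 1) + ρ)‖w‖²` for the
  weight `twt = δ·dist(·,T)`, `ρ ≥ Σ_y |K(x,y)| (cosh(δ·edist(x,y)) − 1)`), the two coercivity transfers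
  (`torusKernel_coercive_of_nonneg`: `min(2,a)`; `torusKernel_coercive_of_schur`: `min(2,a) − ρ₀`),
  **`setDecay_torus_kernel`**: under `σ'‖ω‖² ≤ ⟨ω, Hω⟩` and `2dδ² + a(e^δ − 1) + ρ ≤ σ'/2`, for `g` supported in `T`
  and `S` at `edist`-distance `≥ R` from `T`, `Σ_{x∈S} (H⁻¹g)(x)² ≤ (2/σ')² e^{−2δR} Σ_x g(x)²` — for EVERY mesh;
  `torusKernel_isUnit`, **`torusKernel_inv_entry_bound`**: `|H⁻¹(x,y)| ≤ (2/σ') e^{−δ·edist(x,y)}`; and the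
  FINITE-RANGE SECOND-ORDER packaging `coshRowSum_le_of_range` / `setDecay_torus_kernel_range` /
  `torusKernel_inv_entry_bound_range`: if `K(x,y) ≠ 0 ⇒ edist(x,y) ≤ 1` and `Σ_y |K(x,y)| edist(x,y)² ≤ m₂` (an
  `η`-free size for a second-order difference operator: entries `~η⁻²`, range `~η`, `O(1)` neighbours), then
  `ρ = δ² m₂` (via the tree's `QuantumLattice.cosh_sub_one_le_sq_of_abs_le_one`) and the smallness reads
  `(2d + m₂)δ² + a(e^δ − 1) ≤ σ'/2` — a `δ = δ(d, a, m₂, σ') > 0` exists, independent of `η` and of the periods.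
  Consistency: with `K = 0` the theorem returns exactly the sibling `TorusG0Decay.setDecay_torus` (last `example`).

CONTEXT (not asserted; for the reader of `HOME/BETA/AN2.md` §8.11(h)).  an2's census of what remains for the all-`η`
decay of the finite `U = 1` list of operators («(ii) the NON-LOCAL members …: `combesThomas_form` applies verbatim
once the conjugation defect of the non-local part is form-bounded …, i.e. one more `conjError_…` lemma for
exponentially decaying kernels (Schur with the decay weight)») names the generic lemma of §1; §3 is its torus
instance with the kernel `K` left ABSTRACT.  The operators of that list carry, besides `−Δ^η + aQ*Q`, non-local
symmetric terms (a gauge-fixing term of the shape `D R D*` and averaged/inverted compositions; see the citation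
header of `QGQInverse` for the printed sentence of [Balaban1985VariationalBackground] p. 297 naming
`Δ_a = Δ + DRD* + Q*aQ`); whether a given such term satisfies the weighted-Schur hypothesis `hρ` (or the finite-range
second-moment hypotheses `hKr`/`hm2`) with `η`-free constants is an instantiation question this module does NOT
decide.  The Combes–Thomas device is [cite: CombesThomas1973, §II]; everything here is [folklore].

WHAT THIS MODULE DOES NOT GIVE. (i) Any statement about Bałaban's specific non-local operators (`𝒟_a⁻¹`,
`(Q_kG_aQ_k*)⁻¹`, `𝓗_k(1)`): `K` is abstract and the verification of `hρ` / `hm2` for them is not done here;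
(ii) gradient / divergence-form versions with a kernel term (the siblings' `gradSq_le_form` needs the pure
`lap + blocks` shape; with `K` one needs `K ≥ 0` as a form or a separate argument); (iii) covariant (`U ≠ 1`)
operators; (iv) periods `≤ 2`; (v) complex or non-symmetric `K` beyond the first-order lemma `conjError_kernel_ge`.
-/

open Finset Matrix

namespace Literature.MathematicalPhysics.QuantumFieldTheory.Balaban1983to89.Beta.CombesThomasKernel

open B5Prop11Plancherel (Tor fine unitVec)
open CombesThomasForm (lap abs_exp_sub_one_le)
open CombesThomasFormOp (combesThomas_form_op setDecay_form_op distTo le_distTo distTo_le_zero_of_mem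
  abs_distTo_sub_le pointwise_of_setDecay)
open TorusG0Decay (torusOp coercive_torus edist)
open TorusG0DivDecay (twt twt_of_mem le_twt_of_far abs_twt_sub_le torusOp_defect_ge defect_ge_lattice_dist
  edist_self edist_symm edist_triangle edist_nonneg)
open QGQInverse (form_abs_le_of_schur isUnit_of_coercive mulVec_single_one_apply)
open Literature.MathematicalPhysics.QuantumLattice (cosh_sub_one_le_sq_of_abs_le_one)

noncomputable section

/-! ## §1  Generic: the defect of a kernel -/

section Generic

variable {ι : Type*} [Fintype ι]

/-- `|(e^s − 1) r| ≤ |r| (e^{|s|} − 1)`. [folklore] -/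
theorem abs_expSubOne_mul_le (s r : ℝ) : |(Real.exp s - 1) * r| ≤ |r| * (Real.exp |s| - 1) := by
  rw [abs_mul, mul_comm]
  exact mul_le_mul_of_nonneg_left (abs_exp_sub_one_le le_rfl) (abs_nonneg r)

/-- `e^{|s|} − 1` is monotone in a Lipschitz bound of the exponent. [folklore] -/
theorem expWeight_le {s θ : ℝ} (h : |s| ≤ θ) : Real.exp |s| - 1 ≤ Real.exp θ - 1 := by
  linarith [Real.exp_le_exp.2 h]

/-- `cosh s − 1` is monotone in a Lipschitz bound of the argument. [folklore] -/
theorem coshWeight_le {s θ : ℝ} (h : |s| ≤ θ) : Real.cosh s - 1 ≤ Real.cosh θ - 1 := by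
  have : Real.cosh s ≤ Real.cosh θ := Real.cosh_le_cosh.2 (h.trans (le_abs_self θ))
  linarith

/-- `0 ≤ cosh s − 1`. [folklore] -/
theorem coshWeight_nonneg (s : ℝ) : 0 ≤ Real.cosh s - 1 := by
  linarith [Real.one_le_cosh s]

/-- the conjugation defect is the quadratic form of the entrywise-weighted kernel. [folklore] -/
theorem defect_eq_form (K : Matrix ι ι ℝ) (φ w : ι → ℝ) :
    ∑ j, ∑ k, (Real.exp (φ j - φ k) - 1) * K j k * (w j * w k)
      = w ⬝ᵥ (Matrix.of fun j k => (Real.exp (φ j - φ k) - 1) * K j k) *ᵥ w := by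
  simp only [dotProduct, Matrix.mulVec, Matrix.of_apply, Finset.mul_sum]
  exact Finset.sum_congr rfl fun j _ => Finset.sum_congr rfl fun k _ => by ring

/-- **Conjugation defect of an arbitrary real kernel (first order; Schur with the decay weight).**  If the
`(e^{|φ_j − φ_k|} − 1)`-weighted absolute row AND column sums of `K` are `≤ ρ` (`0 ≤ ρ`), then
`Σ_{j,k} (e^{φ_j−φ_k} − 1) K_jk w_j w_k ≥ −ρ‖w‖²`. [folklore] -/
theorem conjError_kernel_ge (K : Matrix ι ι ℝ) (φ : ι → ℝ) {ρ : ℝ} (hρ : 0 ≤ ρ)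
    (hrow : ∀ j, ∑ k, |K j k| * (Real.exp |φ j - φ k| - 1) ≤ ρ)
    (hcol : ∀ k, ∑ j, |K j k| * (Real.exp |φ j - φ k| - 1) ≤ ρ) (w : ι → ℝ) :
    -ρ * (w ⬝ᵥ w) ≤ ∑ j, ∑ k, (Real.exp (φ j - φ k) - 1) * K j k * (w j * w k) := by
  rw [defect_eq_form]
  set E : Matrix ι ι ℝ := Matrix.of fun j k => (Real.exp (φ j - φ k) - 1) * K j k with hE
  have hEjk : ∀ j k, |E j k| ≤ |K j k| * (Real.exp |φ j - φ k| - 1) := fun j k => by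
    simp only [hE, Matrix.of_apply]; exact abs_expSubOne_mul_le _ _
  have hR' : ∀ j, ∑ k, |E j k| ≤ ρ := fun j => (Finset.sum_le_sum fun k _ => hEjk j k).trans (hrow j)
  have hC' : ∀ k, ∑ j, |E j k| ≤ ρ := fun k => (Finset.sum_le_sum fun j _ => hEjk j k).trans (hcol k)
  have h := form_abs_le_of_schur E hρ (le_of_eq (sq ρ).symm) hR' hC' w
  have h2 := neg_abs_le (w ⬝ᵥ E *ᵥ w)
  linarith

/-- **The symmetrisation identity**: for a SYMMETRIC kernel the odd part of the weight cancels,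
`Σ_{j,k} (e^{φ_j−φ_k} − 1) K_jk w_j w_k = Σ_{j,k} (cosh(φ_j−φ_k) − 1) K_jk w_j w_k`. [folklore] -/
theorem defect_symm_eq_cosh (K : Matrix ι ι ℝ) (hK : ∀ j k, K j k = K k j) (φ w : ι → ℝ) :
    ∑ j, ∑ k, (Real.exp (φ j - φ k) - 1) * K j k * (w j * w k)
      = ∑ j, ∑ k, (Real.cosh (φ j - φ k) - 1) * K j k * (w j * w k) := by
  have hcosh : ∀ j k, Real.cosh (φ j - φ k) - 1 =
      ((Real.exp (φ j - φ k) - 1) + (Real.exp (φ k - φ j) - 1)) / 2 := by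
    intro j k
    rw [Real.cosh_eq, show φ k - φ j = -(φ j - φ k) by ring]
    ring
  have hswap : ∑ j, ∑ k, (Real.exp (φ j - φ k) - 1) * K j k * (w j * w k)
      = ∑ j, ∑ k, (Real.exp (φ k - φ j) - 1) * K j k * (w j * w k) := by
    rw [Finset.sum_comm]
    exact Finset.sum_congr rfl fun j _ => Finset.sum_congr rfl fun k _ => by rw [hK k j]; ring
  have h3 : ∑ j, ∑ k, (Real.cosh (φ j - φ k) - 1) * K j k * (w j * w k)
      = (∑ j, ∑ k, (Real.exp (φ j - φ k) - 1) * K j k * (w j * w k)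
          + ∑ j, ∑ k, (Real.exp (φ k - φ j) - 1) * K j k * (w j * w k)) / 2 := by
    rw [← Finset.sum_add_distrib, Finset.sum_div]
    refine Finset.sum_congr rfl fun j _ => ?_
    rw [← Finset.sum_add_distrib, Finset.sum_div]
    exact Finset.sum_congr rfl fun k _ => by rw [hcosh j k]; ring
  rw [h3, ← hswap]; ring

/-- **Conjugation defect of a SYMMETRIC kernel (second order).**  If the `(cosh(φ_j − φ_k) − 1)`-weighted absolute
ROW sums of the symmetric kernel `K` are `≤ ρ`, then `Σ_{j,k} (e^{φ_j−φ_k} − 1) K_jk w_j w_k ≥ −ρ‖w‖²` (the column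
sums equal the row sums by symmetry; no sign hypothesis on `K` or `ρ`). [folklore] -/
theorem conjError_symmKernel_ge (K : Matrix ι ι ℝ) (hK : ∀ j k, K j k = K k j) (φ : ι → ℝ) {ρ : ℝ}
    (hrow : ∀ j, ∑ k, |K j k| * (Real.cosh (φ j - φ k) - 1) ≤ ρ) (w : ι → ℝ) :
    -ρ * (w ⬝ᵥ w) ≤ ∑ j, ∑ k, (Real.exp (φ j - φ k) - 1) * K j k * (w j * w k) := by
  rw [defect_symm_eq_cosh K hK]
  have hterm : ∀ j k, -(|K j k| * (Real.cosh (φ j - φ k) - 1) * ((w j ^ 2 + w k ^ 2) / 2))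
      ≤ (Real.cosh (φ j - φ k) - 1) * K j k * (w j * w k) := by
    intro j k
    have h1 : |K j k * (w j * w k)| ≤ |K j k| * ((w j ^ 2 + w k ^ 2) / 2) := by
      rw [abs_mul]
      refine mul_le_mul_of_nonneg_left ?_ (abs_nonneg _)
      rw [abs_le]
      constructor <;> nlinarith [sq_nonneg (w j - w k), sq_nonneg (w j + w k)]
    have h2 := neg_abs_le (K j k * (w j * w k))
    have h3 := coshWeight_nonneg (φ j - φ k)
    calc -(|K j k| * (Real.cosh (φ j - φ k) - 1) * ((w j ^ 2 + w k ^ 2) / 2))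
        = (Real.cosh (φ j - φ k) - 1) * (-(|K j k| * ((w j ^ 2 + w k ^ 2) / 2))) := by ring
      _ ≤ (Real.cosh (φ j - φ k) - 1) * (K j k * (w j * w k)) :=
          mul_le_mul_of_nonneg_left (by linarith) h3
      _ = (Real.cosh (φ j - φ k) - 1) * K j k * (w j * w k) := by ring
  have hsymmA : ∀ j k, |K j k| * (Real.cosh (φ j - φ k) - 1) = |K k j| * (Real.cosh (φ k - φ j) - 1) := by
    intro j k; rw [hK j k, show φ k - φ j = -(φ j - φ k) by ring, Real.cosh_neg]
  have hX : ∑ j, ∑ k, |K j k| * (Real.cosh (φ j - φ k) - 1) * w k ^ 2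
      = ∑ j, ∑ k, |K j k| * (Real.cosh (φ j - φ k) - 1) * w j ^ 2 := by
    rw [Finset.sum_comm]
    exact Finset.sum_congr rfl fun j _ => Finset.sum_congr rfl fun k _ => by rw [hsymmA k j]
  have hlow : -(ρ * (w ⬝ᵥ w)) ≤ ∑ j, ∑ k, (Real.cosh (φ j - φ k) - 1) * K j k * (w j * w k) := by
    calc -(ρ * (w ⬝ᵥ w)) ≤ -∑ j, w j ^ 2 * ∑ k, |K j k| * (Real.cosh (φ j - φ k) - 1) := by
          rw [neg_le_neg_iff]
          calc ∑ j, w j ^ 2 * ∑ k, |K j k| * (Real.cosh (φ j - φ k) - 1) ≤ ∑ j, w j ^ 2 * ρ :=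
                Finset.sum_le_sum fun j _ => mul_le_mul_of_nonneg_left (hrow j) (sq_nonneg _)
            _ = ρ * (w ⬝ᵥ w) := by
                rw [← Finset.sum_mul, mul_comm]
                simp only [dotProduct, pow_two]
      _ = -∑ j, ∑ k, |K j k| * (Real.cosh (φ j - φ k) - 1) * ((w j ^ 2 + w k ^ 2) / 2) := by
          congr 1
          have e1 : ∑ j, ∑ k, |K j k| * (Real.cosh (φ j - φ k) - 1) * ((w j ^ 2 + w k ^ 2) / 2)
              = (∑ j, ∑ k, |K j k| * (Real.cosh (φ j - φ k) - 1) * w j ^ 2) / 2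
                + (∑ j, ∑ k, |K j k| * (Real.cosh (φ j - φ k) - 1) * w k ^ 2) / 2 := by
            rw [Finset.sum_div, Finset.sum_div, ← Finset.sum_add_distrib]
            refine Finset.sum_congr rfl fun j _ => ?_
            rw [Finset.sum_div, Finset.sum_div, ← Finset.sum_add_distrib]
            exact Finset.sum_congr rfl fun k _ => by ring
          rw [e1, hX, add_halves]
          refine Finset.sum_congr rfl fun j _ => ?_
          rw [Finset.mul_sum]
          exact Finset.sum_congr rfl fun k _ => by ring
      _ ≤ ∑ j, ∑ k, (Real.cosh (φ j - φ k) - 1) * K j k * (w j * w k) := by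
          rw [← Finset.sum_neg_distrib]
          refine Finset.sum_le_sum fun j _ => ?_
          rw [← Finset.sum_neg_distrib]
          exact Finset.sum_le_sum fun k _ => hterm j k
  linarith

/-- first-order lemma with a Lipschitz weight: `|φ_j − φ_k| ≤ θ·dist(j,k)` and WEIGHT-FREE hypotheses
`Σ_k |K_jk| (e^{θ dist(j,k)} − 1) ≤ ρ` (rows and columns). [folklore] -/
theorem conjError_kernel_ge_of_lipschitz (K : Matrix ι ι ℝ) (φ : ι → ℝ) (dist : ι → ι → ℝ) {θ ρ : ℝ}
    (hρ : 0 ≤ ρ) (hlip : ∀ j k, |φ j - φ k| ≤ θ * dist j k)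
    (hrow : ∀ j, ∑ k, |K j k| * (Real.exp (θ * dist j k) - 1) ≤ ρ)
    (hcol : ∀ k, ∑ j, |K j k| * (Real.exp (θ * dist j k) - 1) ≤ ρ) (w : ι → ℝ) :
    -ρ * (w ⬝ᵥ w) ≤ ∑ j, ∑ k, (Real.exp (φ j - φ k) - 1) * K j k * (w j * w k) :=
  conjError_kernel_ge K φ hρ
    (fun j => (Finset.sum_le_sum fun k _ =>
      mul_le_mul_of_nonneg_left (expWeight_le (hlip j k)) (abs_nonneg _)).trans (hrow j))
    (fun k => (Finset.sum_le_sum fun j _ =>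
      mul_le_mul_of_nonneg_left (expWeight_le (hlip j k)) (abs_nonneg _)).trans (hcol k)) w

/-- second-order lemma with a Lipschitz weight: `K` symmetric, `|φ_j − φ_k| ≤ θ·dist(j,k)` and the WEIGHT-FREE
hypothesis `Σ_k |K_jk| (cosh(θ dist(j,k)) − 1) ≤ ρ` (rows). [folklore] -/
theorem conjError_symmKernel_ge_of_lipschitz (K : Matrix ι ι ℝ) (hK : ∀ j k, K j k = K k j) (φ : ι → ℝ)
    (dist : ι → ι → ℝ) {θ ρ : ℝ} (hlip : ∀ j k, |φ j - φ k| ≤ θ * dist j k)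
    (hrow : ∀ j, ∑ k, |K j k| * (Real.cosh (θ * dist j k) - 1) ≤ ρ) (w : ι → ℝ) :
    -ρ * (w ⬝ᵥ w) ≤ ∑ j, ∑ k, (Real.exp (φ j - φ k) - 1) * K j k * (w j * w k) :=
  conjError_symmKernel_ge K hK φ
    (fun j => (Finset.sum_le_sum fun k _ =>
      mul_le_mul_of_nonneg_left (coshWeight_le (hlip j k)) (abs_nonneg _)).trans (hrow j)) w

/-- **Defects add**: `H = H₁ + K` entrywise ⇒ defect(H) = defect(H₁) + defect(K). [folklore] -/
theorem conjError_add (H₁ K H : Matrix ι ι ℝ) (hH : ∀ j k, H j k = H₁ j k + K j k) (φ : ι → ℝ)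
    {ε₁ ε₂ : ℝ} (w : ι → ℝ)
    (h₁ : -ε₁ * (w ⬝ᵥ w) ≤ ∑ j, ∑ k, (Real.exp (φ j - φ k) - 1) * H₁ j k * (w j * w k))
    (h₂ : -ε₂ * (w ⬝ᵥ w) ≤ ∑ j, ∑ k, (Real.exp (φ j - φ k) - 1) * K j k * (w j * w k)) :
    -(ε₁ + ε₂) * (w ⬝ᵥ w) ≤ ∑ j, ∑ k, (Real.exp (φ j - φ k) - 1) * H j k * (w j * w k) := by
  have e : ∑ j, ∑ k, (Real.exp (φ j - φ k) - 1) * H j k * (w j * w k)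
      = ∑ j, ∑ k, (Real.exp (φ j - φ k) - 1) * H₁ j k * (w j * w k)
        + ∑ j, ∑ k, (Real.exp (φ j - φ k) - 1) * K j k * (w j * w k) := by
    rw [← Finset.sum_add_distrib]
    refine Finset.sum_congr rfl fun j _ => ?_
    rw [← Finset.sum_add_distrib]
    exact Finset.sum_congr rfl fun k _ => by rw [hH j k]; ring
  rw [e]
  linarith

/-- coercivity of `H₁` passes to `H₁ + K` when `K` is nonnegative as a form. [folklore] -/
theorem coercive_add_of_form_nonneg (H₁ K : Matrix ι ι ℝ) {σ : ℝ}
    (hpos : ∀ ω : ι → ℝ, σ * (ω ⬝ᵥ ω) ≤ ω ⬝ᵥ H₁.mulVec ω) (hK : ∀ ω : ι → ℝ, 0 ≤ ω ⬝ᵥ K.mulVec ω)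
    (ω : ι → ℝ) : σ * (ω ⬝ᵥ ω) ≤ ω ⬝ᵥ (H₁ + K).mulVec ω := by
  rw [Matrix.add_mulVec, dotProduct_add]
  linarith [hpos ω, hK ω]

/-- coercivity of `H₁` (constant `σ`) passes to `H₁ + K` with constant `σ − ρ₀` when the plain absolute row and
column sums of `K` are `≤ ρ₀` (Schur). [folklore] -/
theorem coercive_add_of_schur (H₁ K : Matrix ι ι ℝ) {σ ρ₀ : ℝ} (hρ₀ : 0 ≤ ρ₀)
    (hpos : ∀ ω : ι → ℝ, σ * (ω ⬝ᵥ ω) ≤ ω ⬝ᵥ H₁.mulVec ω)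
    (hrow : ∀ j, ∑ k, |K j k| ≤ ρ₀) (hcol : ∀ k, ∑ j, |K j k| ≤ ρ₀) (ω : ι → ℝ) :
    (σ - ρ₀) * (ω ⬝ᵥ ω) ≤ ω ⬝ᵥ (H₁ + K).mulVec ω := by
  have h := form_abs_le_of_schur K hρ₀ (le_of_eq (sq ρ₀).symm) hrow hcol ω
  have h2 := neg_abs_le (ω ⬝ᵥ K *ᵥ ω)
  have h3 := hpos ω
  rw [Matrix.add_mulVec, dotProduct_add]
  have e : (σ - ρ₀) * (ω ⬝ᵥ ω) = σ * (ω ⬝ᵥ ω) - ρ₀ * (ω ⬝ᵥ ω) := by ring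
  rw [e]
  have h4 : -(ρ₀ * (ω ⬝ᵥ ω)) ≤ ω ⬝ᵥ K.mulVec ω := by
    have : ω ⬝ᵥ K *ᵥ ω = ω ⬝ᵥ K.mulVec ω := rfl
    linarith
  linarith

/-- a coercive matrix has trivial kernel. [folklore] -/
theorem eq_zero_of_coercive (H : Matrix ι ι ℝ) {σ : ℝ} (hσ : 0 < σ)
    (hpos : ∀ ω : ι → ℝ, σ * (ω ⬝ᵥ ω) ≤ ω ⬝ᵥ H.mulVec ω) {v : ι → ℝ} (hv : H.mulVec v = 0) : v = 0 := by
  have h1 := hpos v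
  rw [hv, dotProduct_zero] at h1
  have hvv0 : 0 ≤ v ⬝ᵥ v := Finset.sum_nonneg fun j _ => mul_self_nonneg _
  have h2 : v ⬝ᵥ v = 0 := by nlinarith
  have h3 : ∑ j, v j ^ 2 = 0 := by simpa [dotProduct, pow_two] using h2
  funext j
  have h4 := (Finset.sum_eq_zero_iff_of_nonneg fun j _ => sq_nonneg (v j)).1 h3 j (Finset.mem_univ j)
  exact (pow_eq_zero_iff two_ne_zero).mp h4

end Generic

/-! ## §2  Generic lattice shape, metric form: `H = lap c + blocks + K` -/

section Lattice

variable {ι : Type*} [Fintype ι]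

/-- **Defect of `lap c + blocks + K` along `φ = δ·distTo d T`** (the sibling `defect_ge_lattice_dist` plus the
symmetric-kernel term): `≥ −(z δ² + a(e^{δD} − 1) + ρ)‖w‖²` with `ρ ≥ Σ_k |K_jk| (cosh(δ d(j,k)) − 1)`.
[folklore] -/
theorem defect_ge_lattice_kernel_dist [DecidableEq ι] {β : Type*} [Fintype β] [DecidableEq β]
    (c : ι → ι → ℝ) (hcs : ∀ j k, c j k = c k j) (hc0 : ∀ j k, 0 ≤ c j k)
    (blk : ι → β) (m : β → ℝ) (hm : ∀ b, 0 ≤ m b) (u : β → ι → ℝ) (hu : ∀ b j, blk j ≠ b → u b j = 0)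
    (K : Matrix ι ι ℝ) (hKs : ∀ j k, K j k = K k j)
    (H : Matrix ι ι ℝ) (hH : ∀ j k, H j k = lap c j k + ∑ b, m b * (u b j * u b k) + K j k)
    (d : ι → ι → ℝ) (hds : ∀ i j, d i j = d j i) (hdt : ∀ i j k, d i k ≤ d i j + d j k)
    {η δ z a D ρ : ℝ} (hη : 0 < η) (hδ : 0 ≤ δ) (h1 : δ * η ≤ 1) (hD : 0 ≤ D)
    (hc : ∀ j k, c j k ≠ 0 → c j k = (η ^ 2)⁻¹ ∧ d j k ≤ η)
    (hz : ∀ j, ((univ.filter fun k => c j k ≠ 0).card : ℝ) ≤ z)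
    (hblk : ∀ j k, blk j = blk k → d j k ≤ D)
    (ha : ∀ b, m b * ∑ k, u b k ^ 2 ≤ a)
    (hρ : ∀ j, ∑ k, |K j k| * (Real.cosh (δ * d j k) - 1) ≤ ρ)
    (T : Finset ι) (hT : T.Nonempty) (w : ι → ℝ) :
    -(z * δ ^ 2 + a * (Real.exp (δ * D) - 1) + ρ) * (w ⬝ᵥ w)
      ≤ ∑ j, ∑ k, (Real.exp (δ * distTo d T hT j - δ * distTo d T hT k) - 1) * H j k * (w j * w k) := by
  have hloc := defect_ge_lattice_dist c hcs hc0 blk m hm u hu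
    (Matrix.of fun j k => lap c j k + ∑ b, m b * (u b j * u b k)) (fun j k => rfl) d hds hdt hη hδ h1 hD hc
    hz hblk ha T hT w
  have hlip : ∀ j k, |δ * distTo d T hT j - δ * distTo d T hT k| ≤ δ * d j k := by
    intro j k
    rw [← mul_sub, abs_mul, abs_of_nonneg hδ]
    exact mul_le_mul_of_nonneg_left (abs_distTo_sub_le d hds hdt T hT j k) hδ
  have hker := conjError_symmKernel_ge_of_lipschitz K hKs (fun j => δ * distTo d T hT j) d hlip hρ w
  exact conjError_add (Matrix.of fun j k => lap c j k + ∑ b, m b * (u b j * u b k)) K H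
    (fun j k => by rw [hH j k]; rfl) _ w hloc hker

/-- **Set-to-set decay for `H = lap c + blocks + K`, metric form.**  As the sibling `setDecay_lattice_dist` with a
symmetric kernel `K` added and the `η`-free smallness `z δ² + a(e^{δD} − 1) + ρ ≤ σ/2`
(`ρ ≥ Σ_k |K_jk| (cosh(δ d(j,k)) − 1)`; coercivity `σ` of the FULL `H`); conclusion: for `g` supported in a nonempty
`T` and `S` at `d`-distance `≥ R` from `T`, `Σ_{i∈S} (H⁻¹g)_i² ≤ (2/σ)² e^{−2δR} Σ_j g_j²`.
[cite: CombesThomas1973, §II] [folklore] -/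
theorem setDecay_lattice_kernel_dist [DecidableEq ι] {β : Type*} [Fintype β] [DecidableEq β]
    (c : ι → ι → ℝ) (hcs : ∀ j k, c j k = c k j) (hc0 : ∀ j k, 0 ≤ c j k)
    (blk : ι → β) (m : β → ℝ) (hm : ∀ b, 0 ≤ m b) (u : β → ι → ℝ) (hu : ∀ b j, blk j ≠ b → u b j = 0)
    (K : Matrix ι ι ℝ) (hKs : ∀ j k, K j k = K k j)
    (H : Matrix ι ι ℝ) (hH : ∀ j k, H j k = lap c j k + ∑ b, m b * (u b j * u b k) + K j k)
    (σ : ℝ) (hσ : 0 < σ) (hpos : ∀ ω : ι → ℝ, σ * (ω ⬝ᵥ ω) ≤ ω ⬝ᵥ H.mulVec ω)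
    (d : ι → ι → ℝ) (hd0 : ∀ i, d i i = 0) (hds : ∀ i j, d i j = d j i)
    (hdt : ∀ i j k, d i k ≤ d i j + d j k)
    {η δ z a D ρ : ℝ} (hη : 0 < η) (hδ : 0 ≤ δ) (h1 : δ * η ≤ 1) (hD : 0 ≤ D)
    (hc : ∀ j k, c j k ≠ 0 → c j k = (η ^ 2)⁻¹ ∧ d j k ≤ η)
    (hz : ∀ j, ((univ.filter fun k => c j k ≠ 0).card : ℝ) ≤ z)
    (hblk : ∀ j k, blk j = blk k → d j k ≤ D)
    (ha : ∀ b, m b * ∑ k, u b k ^ 2 ≤ a)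
    (hρ : ∀ j, ∑ k, |K j k| * (Real.cosh (δ * d j k) - 1) ≤ ρ)
    (hsmall : z * δ ^ 2 + a * (Real.exp (δ * D) - 1) + ρ ≤ σ / 2)
    (S T : Finset ι) (hT : T.Nonempty) (R : ℝ) (hR : ∀ i ∈ S, ∀ t ∈ T, R ≤ d i t)
    (g v : ι → ℝ) (hg : ∀ j, j ∉ T → g j = 0) (hv : H.mulVec v = g) :
    ∑ i ∈ S, v i ^ 2 ≤ (2 / σ) ^ 2 * Real.exp (-(2 * (δ * R))) * ∑ j, g j ^ 2 := by
  have herr : ∀ w : ι → ℝ, -(σ / 2) * (w ⬝ᵥ w)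
      ≤ ∑ j, ∑ k, (Real.exp (δ * distTo d T hT j - δ * distTo d T hT k) - 1) * H j k * (w j * w k) := by
    intro w
    have h := defect_ge_lattice_kernel_dist c hcs hc0 blk m hm u hu K hKs H hH d hds hdt hη hδ h1 hD hc hz
      hblk ha hρ T hT w
    have hww : 0 ≤ w ⬝ᵥ w := Finset.sum_nonneg fun j _ => mul_self_nonneg _
    nlinarith
  have h := setDecay_form_op H σ (fun j => δ * distTo d T hT j) hσ hpos herr S T (δ * R) 0
    (fun i hi => mul_le_mul_of_nonneg_left (le_distTo d T hT fun t ht => hR i hi t ht) hδ)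
    (fun j hj => mul_nonpos_iff.2 (Or.inl ⟨hδ, distTo_le_zero_of_mem d hd0 T hT hj⟩)) g v hg hv
  simpa using h

end Lattice

/-! ## §3  The torus instance: `H = torusOp n M a + K` -/

section Torus

variable {d : ℕ} (n : ℕ) (M : Fin d → ℕ) [hM : ∀ μ, NeZero (M μ)]

/-- **Defect of `−Δ^η + aQ*Q + K` on the torus along `twt = δ·dist(·,T)`**: `≥ −(2dδ² + a(e^δ − 1) + ρ)‖w‖²`
with `ρ ≥ Σ_y |K(x,y)| (cosh(δ·edist(x,y)) − 1)`, for every mesh (periods `≥ 3`, `0 ≤ δ ≤ 1`). [folklore] -/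
theorem torusKernel_defect_ge (h3 : ∀ μ, 3 ≤ fine (n + 1) M μ) {a δ ρ : ℝ} (ha : 0 < a) (hδ0 : 0 ≤ δ)
    (hδ1 : δ ≤ 1) (K : Matrix (Tor (fine (n + 1) M)) (Tor (fine (n + 1) M)) ℝ) (hKs : ∀ x y, K x y = K y x)
    (hρ : ∀ x, ∑ y, |K x y| * (Real.cosh (δ * edist n M x y) - 1) ≤ ρ)
    (T : Finset (Tor (fine (n + 1) M))) (hT : T.Nonempty) (w : Tor (fine (n + 1) M) → ℝ) :
    -(2 * (d : ℝ) * δ ^ 2 + a * (Real.exp δ - 1) + ρ) * (w ⬝ᵥ w)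
      ≤ ∑ j, ∑ k, (Real.exp (twt n M δ T hT j - twt n M δ T hT k) - 1) * (torusOp n M a + K) j k
          * (w j * w k) := by
  have hloc := torusOp_defect_ge n M h3 ha hδ0 hδ1 T hT w
  have hker := conjError_symmKernel_ge_of_lipschitz K hKs (twt n M δ T hT) (edist n M)
    (abs_twt_sub_le n M hδ0 T hT) hρ w
  exact conjError_add (torusOp n M a) K (torusOp n M a + K) (fun j k => rfl) _ w hloc hker

/-- the defect hypothesis `herr` of the Combes–Thomas modules for `torusOp + K`, under the `η`-free smallness
`2dδ² + a(e^δ − 1) + ρ ≤ σ'/2`. [folklore] -/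
theorem torusKernel_herr (h3 : ∀ μ, 3 ≤ fine (n + 1) M μ) {a δ ρ σ' : ℝ} (ha : 0 < a) (hδ0 : 0 ≤ δ)
    (hδ1 : δ ≤ 1) (K : Matrix (Tor (fine (n + 1) M)) (Tor (fine (n + 1) M)) ℝ) (hKs : ∀ x y, K x y = K y x)
    (hρ : ∀ x, ∑ y, |K x y| * (Real.cosh (δ * edist n M x y) - 1) ≤ ρ)
    (hsmall : 2 * (d : ℝ) * δ ^ 2 + a * (Real.exp δ - 1) + ρ ≤ σ' / 2)
    (T : Finset (Tor (fine (n + 1) M))) (hT : T.Nonempty) (w : Tor (fine (n + 1) M) → ℝ) :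
    -(σ' / 2) * (w ⬝ᵥ w)
      ≤ ∑ j, ∑ k, (Real.exp (twt n M δ T hT j - twt n M δ T hT k) - 1) * (torusOp n M a + K) j k
          * (w j * w k) := by
  have h := torusKernel_defect_ge n M h3 ha hδ0 hδ1 K hKs hρ T hT w
  have hww : 0 ≤ w ⬝ᵥ w := Finset.sum_nonneg fun j _ => mul_self_nonneg _
  nlinarith

/-- coercivity `min(2,a)` survives a form-nonnegative kernel. [folklore] -/
theorem torusKernel_coercive_of_nonneg (h3 : ∀ μ, 3 ≤ fine (n + 1) M μ) {a : ℝ} (ha : 0 ≤ a)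
    (K : Matrix (Tor (fine (n + 1) M)) (Tor (fine (n + 1) M)) ℝ)
    (hK : ∀ ω : Tor (fine (n + 1) M) → ℝ, 0 ≤ ω ⬝ᵥ K.mulVec ω) (ω : Tor (fine (n + 1) M) → ℝ) :
    min 2 a * (ω ⬝ᵥ ω) ≤ ω ⬝ᵥ (torusOp n M a + K).mulVec ω :=
  coercive_add_of_form_nonneg (torusOp n M a) K (coercive_torus n M h3 ha) hK ω

/-- coercivity `min(2,a) − ρ₀` for a kernel with plain absolute row/column sums `≤ ρ₀`. [folklore] -/
theorem torusKernel_coercive_of_schur (h3 : ∀ μ, 3 ≤ fine (n + 1) M μ) {a ρ₀ : ℝ} (ha : 0 ≤ a) (hρ₀ : 0 ≤ ρ₀)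
    (K : Matrix (Tor (fine (n + 1) M)) (Tor (fine (n + 1) M)) ℝ)
    (hrow : ∀ x, ∑ y, |K x y| ≤ ρ₀) (hcol : ∀ y, ∑ x, |K x y| ≤ ρ₀) (ω : Tor (fine (n + 1) M) → ℝ) :
    (min 2 a - ρ₀) * (ω ⬝ᵥ ω) ≤ ω ⬝ᵥ (torusOp n M a + K).mulVec ω :=
  coercive_add_of_schur (torusOp n M a) K hρ₀ (coercive_torus n M h3 ha) hrow hcol ω

/-- **Set-to-set decay of `(−Δ^η + aQ*Q + K)⁻¹` on the torus, uniformly in the mesh.**  `K` symmetric with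
`Σ_y |K(x,y)| (cosh(δ·edist(x,y)) − 1) ≤ ρ`; coercivity `σ' > 0` of `H = torusOp + K`; `η`-free smallness
`2dδ² + a(e^δ − 1) + ρ ≤ σ'/2`.  Then for `g` supported in `T`, `S` at `edist`-distance `≥ R` from `T` and any
solution of `H v = g`: `Σ_{x∈S} v(x)² ≤ (2/σ')² e^{−2δR} Σ_x g(x)²`. [cite: CombesThomas1973, §II] [folklore] -/
theorem setDecay_torus_kernel (h3 : ∀ μ, 3 ≤ fine (n + 1) M μ) {a δ ρ σ' : ℝ} (ha : 0 < a) (hδ0 : 0 ≤ δ)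
    (hδ1 : δ ≤ 1) (K : Matrix (Tor (fine (n + 1) M)) (Tor (fine (n + 1) M)) ℝ) (hKs : ∀ x y, K x y = K y x)
    (hσ' : 0 < σ')
    (hpos : ∀ ω : Tor (fine (n + 1) M) → ℝ, σ' * (ω ⬝ᵥ ω) ≤ ω ⬝ᵥ (torusOp n M a + K).mulVec ω)
    (hρ : ∀ x, ∑ y, |K x y| * (Real.cosh (δ * edist n M x y) - 1) ≤ ρ)
    (hsmall : 2 * (d : ℝ) * δ ^ 2 + a * (Real.exp δ - 1) + ρ ≤ σ' / 2)
    (S T : Finset (Tor (fine (n + 1) M))) (R : ℝ) (hR : ∀ x ∈ S, ∀ t ∈ T, R ≤ edist n M x t)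
    (g v : Tor (fine (n + 1) M) → ℝ) (hg : ∀ x, x ∉ T → g x = 0) (hv : (torusOp n M a + K).mulVec v = g) :
    ∑ x ∈ S, v x ^ 2 ≤ (2 / σ') ^ 2 * Real.exp (-(2 * (δ * R))) * ∑ x, g x ^ 2 := by
  classical
  rcases T.eq_empty_or_nonempty with hT | hT
  · have hg0 : g = 0 := funext fun x => hg x (by simp [hT])
    have hv0 : v = 0 := eq_zero_of_coercive _ hσ' hpos (by rw [hv, hg0])
    subst hg0; subst hv0
    simp
  · have herr := fun w => torusKernel_herr n M h3 ha hδ0 hδ1 K hKs hρ hsmall T hT w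
    have h := setDecay_form_op (torusOp n M a + K) σ' (twt n M δ T hT) hσ' hpos herr S T (δ * R) 0
      (fun x hx => le_twt_of_far n M hδ0 T hT R (hR x hx)) (fun x hx => (twt_of_mem n M δ T hT hx).le)
      g v hg hv
    simpa using h

/-- `torusOp + K` is invertible under coercivity. [folklore] -/
theorem torusKernel_isUnit {a σ' : ℝ} (K : Matrix (Tor (fine (n + 1) M)) (Tor (fine (n + 1) M)) ℝ)
    (hσ' : 0 < σ')
    (hpos : ∀ ω : Tor (fine (n + 1) M) → ℝ, σ' * (ω ⬝ᵥ ω) ≤ ω ⬝ᵥ (torusOp n M a + K).mulVec ω) :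
    IsUnit (torusOp n M a + K) :=
  isUnit_of_coercive hσ' hpos

/-- `H H⁻¹ g = g` for `H = torusOp + K` coercive. [folklore] -/
theorem torusKernel_mulVec_inv {a σ' : ℝ} (K : Matrix (Tor (fine (n + 1) M)) (Tor (fine (n + 1) M)) ℝ)
    (hσ' : 0 < σ')
    (hpos : ∀ ω : Tor (fine (n + 1) M) → ℝ, σ' * (ω ⬝ᵥ ω) ≤ ω ⬝ᵥ (torusOp n M a + K).mulVec ω)
    (g : Tor (fine (n + 1) M) → ℝ) :
    (torusOp n M a + K).mulVec ((torusOp n M a + K)⁻¹.mulVec g) = g := by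
  have hdet : IsUnit (torusOp n M a + K).det :=
    (Matrix.isUnit_iff_isUnit_det _).mp (torusKernel_isUnit n M K hσ' hpos)
  rw [Matrix.mulVec_mulVec, Matrix.mul_nonsing_inv _ hdet, Matrix.one_mulVec]

/-- **Entry bound for the inverse kernel**: `|(−Δ^η + aQ*Q + K)⁻¹(x,y)| ≤ (2/σ') e^{−δ·edist(x,y)}` under the
hypotheses of `setDecay_torus_kernel` (`S = {x}`, `T = {y}`, `g = e_y`). [folklore] -/
theorem torusKernel_inv_entry_bound (h3 : ∀ μ, 3 ≤ fine (n + 1) M μ) {a δ ρ σ' : ℝ} (ha : 0 < a)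
    (hδ0 : 0 ≤ δ) (hδ1 : δ ≤ 1) (K : Matrix (Tor (fine (n + 1) M)) (Tor (fine (n + 1) M)) ℝ)
    (hKs : ∀ x y, K x y = K y x) (hσ' : 0 < σ')
    (hpos : ∀ ω : Tor (fine (n + 1) M) → ℝ, σ' * (ω ⬝ᵥ ω) ≤ ω ⬝ᵥ (torusOp n M a + K).mulVec ω)
    (hρ : ∀ x, ∑ y, |K x y| * (Real.cosh (δ * edist n M x y) - 1) ≤ ρ)
    (hsmall : 2 * (d : ℝ) * δ ^ 2 + a * (Real.exp δ - 1) + ρ ≤ σ' / 2) (x y : Tor (fine (n + 1) M)) :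
    |(torusOp n M a + K)⁻¹ x y| ≤ 2 / σ' * Real.exp (-(δ * edist n M x y)) := by
  classical
  have hyy : edist n M y y = 0 := edist_self n M y
  have hv := torusKernel_mulVec_inv n M K hσ' hpos (Pi.single y 1)
  have hdec := setDecay_torus_kernel n M h3 ha hδ0 hδ1 K hKs hσ' hpos hρ hsmall {x} {y} (edist n M x y)
    (fun x' hx' t ht => by rw [Finset.mem_singleton] at hx' ht; rw [hx', ht]) (Pi.single y 1)
    ((torusOp n M a + K)⁻¹.mulVec (Pi.single y 1))
    (fun j hj => by rw [Finset.mem_singleton] at hj; simp [hj]) hv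
  have key : ∑ i' ∈ ({x} : Finset (Tor (fine (n + 1) M))),
      ((torusOp n M a + K)⁻¹.mulVec (Pi.single y 1)) i' ^ 2 ≤
      (2 / σ') ^ 2 * Real.exp (-(2 * (δ * edist n M x y - δ * edist n M y y))) *
        ∑ j, (Pi.single y (1 : ℝ) : Tor (fine (n + 1) M) → ℝ) j ^ 2 := by
    rw [hyy, mul_zero, sub_zero]; exact hdec
  have h : |((torusOp n M a + K)⁻¹.mulVec (Pi.single y 1)) x| ≤
      2 / σ' * Real.exp (-(δ * edist n M x y - δ * edist n M y y)) :=
    pointwise_of_setDecay σ' hσ' (fun j => δ * edist n M j y) _ x y key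
  rw [hyy, mul_zero, sub_zero] at h
  have e : ((torusOp n M a + K)⁻¹.mulVec (Pi.single y 1)) x = (torusOp n M a + K)⁻¹ x y :=
    mulVec_single_one_apply _ x y
  rw [e] at h
  exact h

/-! ### Finite-range second-order kernels: `ρ = δ² m₂` -/

/-- **The weighted row sum of a finite-range kernel is second order in `δ`.**  If `K(x,y) ≠ 0 ⇒ edist(x,y) ≤ 1`
and `Σ_y |K(x,y)| edist(x,y)² ≤ m₂`, then for `0 ≤ δ ≤ 1`: `Σ_y |K(x,y)| (cosh(δ·edist(x,y)) − 1) ≤ δ² m₂`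
(`cosh t − 1 ≤ t²` for `|t| ≤ 1`, the tree's `QuantumLattice.cosh_sub_one_le_sq_of_abs_le_one`).  For a second-order
difference operator in physical units (entries `O(η⁻²)` on `O(1)` neighbours at distance `O(η)`) `m₂ = O(1)`
uniformly in `η`. [folklore] -/
theorem coshRowSum_le_of_range {δ m₂ : ℝ} (hδ0 : 0 ≤ δ) (hδ1 : δ ≤ 1)
    (K : Matrix (Tor (fine (n + 1) M)) (Tor (fine (n + 1) M)) ℝ)
    (hKr : ∀ x y, K x y ≠ 0 → edist n M x y ≤ 1)
    (hm2 : ∀ x, ∑ y, |K x y| * edist n M x y ^ 2 ≤ m₂) (x : Tor (fine (n + 1) M)) :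
    ∑ y, |K x y| * (Real.cosh (δ * edist n M x y) - 1) ≤ δ ^ 2 * m₂ := by
  calc ∑ y, |K x y| * (Real.cosh (δ * edist n M x y) - 1)
      ≤ ∑ y, |K x y| * (δ ^ 2 * edist n M x y ^ 2) := by
        refine Finset.sum_le_sum fun y _ => ?_
        by_cases hK : K x y = 0
        · simp [hK]
        · refine mul_le_mul_of_nonneg_left ?_ (abs_nonneg _)
          have he := hKr x y hK
          have he0 := edist_nonneg n M x y
          have habs : |δ * edist n M x y| ≤ 1 := by
            rw [abs_of_nonneg (mul_nonneg hδ0 he0)]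
            calc δ * edist n M x y ≤ 1 * 1 := mul_le_mul hδ1 he he0 zero_le_one
              _ = 1 := one_mul _
          calc Real.cosh (δ * edist n M x y) - 1 ≤ (δ * edist n M x y) ^ 2 :=
                cosh_sub_one_le_sq_of_abs_le_one habs
            _ = δ ^ 2 * edist n M x y ^ 2 := by ring
    _ = δ ^ 2 * ∑ y, |K x y| * edist n M x y ^ 2 := by
        rw [Finset.mul_sum]
        exact Finset.sum_congr rfl fun y _ => by ring
    _ ≤ δ ^ 2 * m₂ := mul_le_mul_of_nonneg_left (hm2 x) (sq_nonneg _)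

/-- **Set-to-set decay for `torusOp + K`, `K` a symmetric finite-range second-order kernel**: with
`K(x,y) ≠ 0 ⇒ edist(x,y) ≤ 1`, `Σ_y |K(x,y)| edist(x,y)² ≤ m₂`, coercivity `σ'` of `torusOp + K` and the `η`-free
smallness `(2d + m₂)δ² + a(e^δ − 1) ≤ σ'/2`: `Σ_{x∈S} (H⁻¹g)(x)² ≤ (2/σ')² e^{−2δR} Σ_x g(x)²`.
[cite: CombesThomas1973, §II] [folklore] -/
theorem setDecay_torus_kernel_range (h3 : ∀ μ, 3 ≤ fine (n + 1) M μ) {a δ m₂ σ' : ℝ} (ha : 0 < a)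
    (hδ0 : 0 ≤ δ) (hδ1 : δ ≤ 1) (K : Matrix (Tor (fine (n + 1) M)) (Tor (fine (n + 1) M)) ℝ)
    (hKs : ∀ x y, K x y = K y x) (hKr : ∀ x y, K x y ≠ 0 → edist n M x y ≤ 1)
    (hm2 : ∀ x, ∑ y, |K x y| * edist n M x y ^ 2 ≤ m₂) (hσ' : 0 < σ')
    (hpos : ∀ ω : Tor (fine (n + 1) M) → ℝ, σ' * (ω ⬝ᵥ ω) ≤ ω ⬝ᵥ (torusOp n M a + K).mulVec ω)
    (hsmall : (2 * (d : ℝ) + m₂) * δ ^ 2 + a * (Real.exp δ - 1) ≤ σ' / 2)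
    (S T : Finset (Tor (fine (n + 1) M))) (R : ℝ) (hR : ∀ x ∈ S, ∀ t ∈ T, R ≤ edist n M x t)
    (g v : Tor (fine (n + 1) M) → ℝ) (hg : ∀ x, x ∉ T → g x = 0) (hv : (torusOp n M a + K).mulVec v = g) :
    ∑ x ∈ S, v x ^ 2 ≤ (2 / σ') ^ 2 * Real.exp (-(2 * (δ * R))) * ∑ x, g x ^ 2 :=
  setDecay_torus_kernel n M h3 ha hδ0 hδ1 K hKs hσ' hpos (coshRowSum_le_of_range n M hδ0 hδ1 K hKr hm2)
    (by linarith) S T R hR g v hg hv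

/-- entry bound for the inverse of `torusOp + K`, `K` a symmetric finite-range second-order kernel:
`|H⁻¹(x,y)| ≤ (2/σ') e^{−δ·edist(x,y)}` under `(2d + m₂)δ² + a(e^δ − 1) ≤ σ'/2`. [folklore] -/
theorem torusKernel_inv_entry_bound_range (h3 : ∀ μ, 3 ≤ fine (n + 1) M μ) {a δ m₂ σ' : ℝ} (ha : 0 < a)
    (hδ0 : 0 ≤ δ) (hδ1 : δ ≤ 1) (K : Matrix (Tor (fine (n + 1) M)) (Tor (fine (n + 1) M)) ℝ)
    (hKs : ∀ x y, K x y = K y x) (hKr : ∀ x y, K x y ≠ 0 → edist n M x y ≤ 1)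
    (hm2 : ∀ x, ∑ y, |K x y| * edist n M x y ^ 2 ≤ m₂) (hσ' : 0 < σ')
    (hpos : ∀ ω : Tor (fine (n + 1) M) → ℝ, σ' * (ω ⬝ᵥ ω) ≤ ω ⬝ᵥ (torusOp n M a + K).mulVec ω)
    (hsmall : (2 * (d : ℝ) + m₂) * δ ^ 2 + a * (Real.exp δ - 1) ≤ σ' / 2) (x y : Tor (fine (n + 1) M)) :
    |(torusOp n M a + K)⁻¹ x y| ≤ 2 / σ' * Real.exp (-(δ * edist n M x y)) :=
  torusKernel_inv_entry_bound n M h3 ha hδ0 hδ1 K hKs hσ' hpos (coshRowSum_le_of_range n M hδ0 hδ1 K hKr hm2)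
    (by linarith) x y

/-- Consistency (`K = 0`): the kernel theorem returns exactly the sibling `TorusG0Decay.setDecay_torus`
(coercivity `σ' = min(2,a)` from `coercive_torus`, `ρ = 0`). -/
example (h3 : ∀ μ, 3 ≤ fine (n + 1) M μ) {a δ : ℝ} (ha : 0 < a) (hδ0 : 0 ≤ δ) (hδ1 : δ ≤ 1)
    (hsmall : 2 * (d : ℝ) * δ ^ 2 + a * (Real.exp δ - 1) ≤ min 2 a / 2)
    (S T : Finset (Tor (fine (n + 1) M))) (R : ℝ) (hR : ∀ x ∈ S, ∀ t ∈ T, R ≤ edist n M x t)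
    (g v : Tor (fine (n + 1) M) → ℝ) (hg : ∀ x, x ∉ T → g x = 0) (hv : (torusOp n M a).mulVec v = g) :
    ∑ x ∈ S, v x ^ 2 ≤ (2 / min 2 a) ^ 2 * Real.exp (-(2 * (δ * R))) * ∑ x, g x ^ 2 :=
  setDecay_torus_kernel n M h3 ha hδ0 hδ1 0 (fun _ _ => rfl) (lt_min two_pos ha)
    (fun ω => by rw [add_zero]; exact coercive_torus n M h3 ha.le ω) (ρ := 0) (fun x => by simp)
    (by simpa using hsmall) S T R hR g v hg (by rw [add_zero]; exact hv)

end Torus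

end

end Literature.MathematicalPhysics.QuantumFieldTheory.Balaban1983to89.Beta.CombesThomasKernel
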